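import Summits.QuantumFields.BalabanUV.Beta.D1BFx.SliceTransferJets

/-!
# `BalabanUV.Beta.D1BFx.SliceTransferJetsMixed` — road «BF-x» for binder row D1, leaf K-R1 AT MODEL LEVEL, JET FORM (part 3: the MIXED functional)

POLARISATION OF THE JET IDENTITY.  The typed one-loop kernels are BILINEAR in two background bonds (`ExpKernelCalculus.hessKer … μ ν z =
½·tadpole − ½·bubble` = half the MIXED functional `mixedVar A₀ A₁ A₁′ A₂″ := tr(A₀⁻¹A₂″) − tr(A₀⁻¹A₁A₀⁻¹A₁′)` of the jets along the two bonds).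
`secondVar_sliceTransfer_jets` (part 2) is the DIAGONAL statement (one direction).  Here it is polarised: for 2-parameter jet data — first jets
along `b` and `b′`, pure and MIXED second jets — satisfying the algebraic Ward relations along `b`, along `b′` and the mixed one
(`K_{bb′}W₀ + K_bW_{b′} + K_{b′}W_b + K₀W_{bb′} = 0`, + transposes, + the `Q`-relations), the slice-transfer identity holds for the mixed functionals:
`mixedVar M + 2·mixedVar F = mixedVar N + 2·mixedVar G` (`mixedVar_sliceTransfer_jets`) — the shape a kernel∕torus consumer instantiates with its
bond-pair tables (K-R1-SPEC v2 §3–§4).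

HONEST FRAMING (cell contract, verbatim): «discharging `BetaPertH` makes Bałaban's UV stability UNCONDITIONAL — a real constructive-QFT
result; it is NOT the continuum limit and NOT the Clay problem.»  HONEST DEPENDENCY (verbatim): «continuum YM on T⁴ ⇐ BetaPertH ∧ nine
spine estimates (0/9 proved); BetaPertH ⇐ (D1) ∧ (D4) ∧ CAP+tail; G-an2-4 gates asym, D1 and NE2/3/4.»  [folklore] finite-dimensional algebra
over parts 1–2; no `Prop` is minted, nothing is cited, no wall binder is instantiated; 0 sorry.  NOT summit progress.
ABSOLUTE RULE (cell, verbatim): «No internally-minted statement may enter as a cited fact. Every hypothesis is either kernel-proved in this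
package or a verbatim quotation of a PUBLISHED theorem with page reference. The manuscript(s) under audit are NOT citable for their own
disputed steps — they are the thing under adjudication; programme-internal (2001/route/tribunal) claims are never citable.»
Provenance: road «BF-x» owner gen 4 (prover-b2b-balaban-beta-d1-p2-g4-0), K-R1-SPEC v2 §4 X₃(i), 2026-08-20.
-/

noncomputable section

namespace Summit.QuantumFields.BalabanUV.Beta.D1BFx.SliceTransferJetsMixed

open Matrix
open Literature.MathematicalPhysics.QuantumFieldTheory.Balaban1983to89.Beta.Composition (kkt)
open Summit.QuantumFields.BalabanUV.Beta.D1BFx.LogDetSecondVariation (secondVar)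
open Summit.QuantumFields.BalabanUV.Beta.D1BFx.SliceTransferJets (secondVar_sliceTransfer_jets)

/-! ## §1 The mixed functional and polarisation -/

section Mixed

variable {ι : Type*} [Fintype ι] [DecidableEq ι]

/-- [our object] **THE MIXED ONE-LOOP FUNCTIONAL** of a 2-parameter jet (first jets `A₁`, `A₁′` along the two directions, mixed second jet `A₂″`):
`tr(A₀⁻¹A₂″) − tr(A₀⁻¹A₁A₀⁻¹A₁′)` (= `2·hessKer`-shaped: tadpole minus bubble). -/
def mixedVar (A₀ A₁ A₁' A₂'' : Matrix ι ι ℝ) : ℝ :=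
  (A₀⁻¹ * A₂'').trace - (A₀⁻¹ * A₁ * (A₀⁻¹ * A₁')).trace

/-- [folklore] On the diagonal the mixed functional is `secondVar`. -/
theorem mixedVar_self (A₀ A₁ A₂ : Matrix ι ι ℝ) : mixedVar A₀ A₁ A₁ A₂ = secondVar A₀ A₁ A₂ := rfl

/-- [folklore] **POLARISATION**: `secondVar A₀ (A₁ + A₁′) (A₂ + 2·A₂″ + A₂′) = secondVar A₀ A₁ A₂ + secondVar A₀ A₁′ A₂′ + 2·mixedVar A₀ A₁ A₁′ A₂″`. -/
theorem secondVar_diag (A₀ A₁ A₁' A₂ A₂' A₂'' : Matrix ι ι ℝ) :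
    secondVar A₀ (A₁ + A₁') (A₂ + (2 : ℝ) • A₂'' + A₂')
      = secondVar A₀ A₁ A₂ + secondVar A₀ A₁' A₂' + 2 * mixedVar A₀ A₁ A₁' A₂'' := by
  have hc : (A₀⁻¹ * A₁' * (A₀⁻¹ * A₁)).trace = (A₀⁻¹ * A₁ * (A₀⁻¹ * A₁')).trace := Matrix.trace_mul_comm _ _
  simp only [secondVar, mixedVar, Matrix.mul_add, Matrix.add_mul, Matrix.trace_add, Matrix.mul_smul, Matrix.trace_smul, smul_eq_mul, hc]
  ring

end Mixed

/-! ## §2 The slice-transfer identity for the mixed functionals -/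

section Main

variable {ν μ ρ : Type*} [Fintype ν] [Fintype μ] [Fintype ρ] [DecidableEq ν] [DecidableEq μ] [DecidableEq ρ]

omit [Fintype ν] [Fintype μ] [Fintype ρ] [DecidableEq ν] [DecidableEq μ] [DecidableEq ρ] in
/-- [folklore] `kkt` is additive in (form, rows) with a zero third row block. -/
theorem kkt_fromRows_add (A B : Matrix ν ν ℝ) (C D : Matrix μ ν ℝ) :
    kkt (A + B) (fromRows (C + D) (0 : Matrix ρ ν ℝ)) = kkt A (fromRows C 0) + kkt B (fromRows D 0) := by
  ext i j
  rcases i with i | i | i <;> rcases j with j | j | j <;>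
    simp [kkt, Matrix.fromBlocks, Matrix.fromRows, Matrix.add_apply]

omit [Fintype ν] [Fintype μ] [Fintype ρ] [DecidableEq ν] [DecidableEq μ] [DecidableEq ρ] in
/-- [folklore] `kkt` commutes with real scalars (zero third row block). -/
theorem kkt_fromRows_smul (c : ℝ) (A : Matrix ν ν ℝ) (C : Matrix μ ν ℝ) :
    kkt (c • A) (fromRows (c • C) (0 : Matrix ρ ν ℝ)) = c • kkt A (fromRows C 0) := by
  ext i j
  rcases i with i | i | i <;> rcases j with j | j | j <;>
    simp [kkt, Matrix.fromBlocks, Matrix.fromRows, Matrix.smul_apply]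

omit [Fintype ν] [Fintype μ] [DecidableEq ν] [DecidableEq μ] [DecidableEq ρ] in
/-- [folklore] `kkt (A+B) Q` form-additivity for the singly bordered system with a FIXED second argument split `Q = Q` is not needed; what is
needed is full additivity: `kkt (A + B) (C + D) = kkt A C + kkt B D`. -/
theorem kkt_add (A B : Matrix ν ν ℝ) (C D : Matrix μ ν ℝ) : kkt (A + B) (C + D) = kkt A C + kkt B D := by
  ext i j
  rcases i with i | i <;> rcases j with j | j <;> simp [kkt, Matrix.fromBlocks, Matrix.add_apply]

omit [Fintype ν] [Fintype μ] [DecidableEq ν] [DecidableEq μ] [DecidableEq ρ] in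
/-- [folklore] `kkt (c•A) (c•C) = c • kkt A C`. -/
theorem kkt_smul (c : ℝ) (A : Matrix ν ν ℝ) (C : Matrix μ ν ℝ) : kkt (c • A) (c • C) = c • kkt A C := by
  ext i j
  rcases i with i | i <;> rcases j with j | j <;> simp [kkt, Matrix.fromBlocks, Matrix.smul_apply]

/-- [folklore] **K-R1 AT MODEL LEVEL, JET FORM, MIXED FUNCTIONALS.**  2-parameter jet data: first jets `(Kₛ, Qₛ, Pₛ, Wₛ)` along `b`,
`(Kₜ, Qₜ, Pₜ, Wₜ)` along `b′`, pure second jets `…ₛₛ`, `…ₜₜ` and MIXED second jets `(Kₛₜ, Qₛₜ, Pₛₜ, Wₛₜ)`; constant axial rows `τ`.  Under the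
algebraic Ward relations along `b`, along `b′` and the mixed ones (for `K`, `Kᵀ`, `Q`), and `det(τW₀)`, `det(P₀W₀)`, `det kkt K₀ [Q₀; τ] ≠ 0`:
`mixedVar M + 2·mixedVar F = mixedVar N + 2·mixedVar G` with the mixed product-rule jets `Fₛₜ = PₛₜW₀ + PₛWₜ + PₜWₛ + P₀Wₛₜ`,
`Nₛₜ`-form `Kₛₜ + PₛₜᵀP₀ + PₛᵀPₜ + PₜᵀPₛ + P₀ᵀPₛₜ`, `Gₛₜ = τWₛₜ`. -/
theorem mixedVar_sliceTransfer_jets (K₀ Kₛ Kₜ Kₛₛ Kₜₜ Kₛₜ : Matrix ν ν ℝ) (Q₀ Qₛ Qₜ Qₛₛ Qₜₜ Qₛₜ : Matrix μ ν ℝ)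
    (P₀ Pₛ Pₜ Pₛₛ Pₜₜ Pₛₜ : Matrix ρ ν ℝ) (W₀ Wₛ Wₜ Wₛₛ Wₜₜ Wₛₜ : Matrix ν ρ ℝ) (τ : Matrix ρ ν ℝ)
    (a0 : K₀ * W₀ = 0) (a0t : K₀ᵀ * W₀ = 0)
    (aₛ : Kₛ * W₀ + K₀ * Wₛ = 0) (aₛt : Kₛᵀ * W₀ + K₀ᵀ * Wₛ = 0) (aₜ : Kₜ * W₀ + K₀ * Wₜ = 0) (aₜt : Kₜᵀ * W₀ + K₀ᵀ * Wₜ = 0)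
    (aₛₛ : Kₛₛ * W₀ + (2 : ℝ) • (Kₛ * Wₛ) + K₀ * Wₛₛ = 0) (aₛₛt : Kₛₛᵀ * W₀ + (2 : ℝ) • (Kₛᵀ * Wₛ) + K₀ᵀ * Wₛₛ = 0)
    (aₜₜ : Kₜₜ * W₀ + (2 : ℝ) • (Kₜ * Wₜ) + K₀ * Wₜₜ = 0) (aₜₜt : Kₜₜᵀ * W₀ + (2 : ℝ) • (Kₜᵀ * Wₜ) + K₀ᵀ * Wₜₜ = 0)
    (aₛₜ : Kₛₜ * W₀ + Kₛ * Wₜ + Kₜ * Wₛ + K₀ * Wₛₜ = 0) (aₛₜt : Kₛₜᵀ * W₀ + Kₛᵀ * Wₜ + Kₜᵀ * Wₛ + K₀ᵀ * Wₛₜ = 0)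
    (b0 : Q₀ * W₀ = 0) (bₛ : Qₛ * W₀ + Q₀ * Wₛ = 0) (bₜ : Qₜ * W₀ + Q₀ * Wₜ = 0)
    (bₛₛ : Qₛₛ * W₀ + (2 : ℝ) • (Qₛ * Wₛ) + Q₀ * Wₛₛ = 0) (bₜₜ : Qₜₜ * W₀ + (2 : ℝ) • (Qₜ * Wₜ) + Q₀ * Wₜₜ = 0)
    (bₛₜ : Qₛₜ * W₀ + Qₛ * Wₜ + Qₜ * Wₛ + Q₀ * Wₛₜ = 0)
    (hτ : (τ * W₀).det ≠ 0) (hP : (P₀ * W₀).det ≠ 0) (hM : (kkt K₀ (fromRows Q₀ τ)).det ≠ 0) :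
    mixedVar (kkt K₀ (fromRows Q₀ τ)) (kkt Kₛ (fromRows Qₛ (0 : Matrix ρ ν ℝ))) (kkt Kₜ (fromRows Qₜ (0 : Matrix ρ ν ℝ)))
        (kkt Kₛₜ (fromRows Qₛₜ (0 : Matrix ρ ν ℝ)))
      + 2 * mixedVar (P₀ * W₀) (Pₛ * W₀ + P₀ * Wₛ) (Pₜ * W₀ + P₀ * Wₜ) (Pₛₜ * W₀ + Pₛ * Wₜ + Pₜ * Wₛ + P₀ * Wₛₜ)
    = mixedVar (kkt (K₀ + P₀ᵀ * P₀) Q₀) (kkt (Kₛ + (Pₛᵀ * P₀ + P₀ᵀ * Pₛ)) Qₛ) (kkt (Kₜ + (Pₜᵀ * P₀ + P₀ᵀ * Pₜ)) Qₜ)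
        (kkt (Kₛₜ + (Pₛₜᵀ * P₀ + Pₛᵀ * Pₜ + Pₜᵀ * Pₛ + P₀ᵀ * Pₛₜ)) Qₛₜ)
      + 2 * mixedVar (τ * W₀) (τ * Wₛ) (τ * Wₜ) (τ * Wₛₜ) := by
  -- the three one-parameter identities: along b, along b′, along the diagonal
  have hs := secondVar_sliceTransfer_jets K₀ Kₛ Kₛₛ Q₀ Qₛ Qₛₛ P₀ Pₛ Pₛₛ W₀ Wₛ Wₛₛ τ a0 a0t aₛ aₛt aₛₛ aₛₛt b0 bₛ bₛₛ hτ hP hM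
  have ht := secondVar_sliceTransfer_jets K₀ Kₜ Kₜₜ Q₀ Qₜ Qₜₜ P₀ Pₜ Pₜₜ W₀ Wₜ Wₜₜ τ a0 a0t aₜ aₜt aₜₜ aₜₜt b0 bₜ bₜₜ hτ hP hM
  have dK1 : (Kₛ + Kₜ) * W₀ + K₀ * (Wₛ + Wₜ) = 0 := by
    rw [Matrix.add_mul, Matrix.mul_add]; rw [← aₛ, ← add_zero (Kₛ * W₀ + K₀ * Wₛ), ← aₜ]; abel
  have dK1t : (Kₛ + Kₜ)ᵀ * W₀ + K₀ᵀ * (Wₛ + Wₜ) = 0 := by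
    rw [Matrix.transpose_add, Matrix.add_mul, Matrix.mul_add]; rw [← aₛt, ← add_zero (Kₛᵀ * W₀ + K₀ᵀ * Wₛ), ← aₜt]; abel
  have dK2 : (Kₛₛ + (2 : ℝ) • Kₛₜ + Kₜₜ) * W₀ + (2 : ℝ) • ((Kₛ + Kₜ) * (Wₛ + Wₜ)) + K₀ * (Wₛₛ + (2 : ℝ) • Wₛₜ + Wₜₜ) = 0 := by
    have e : (Kₛₛ + (2 : ℝ) • Kₛₜ + Kₜₜ) * W₀ + (2 : ℝ) • ((Kₛ + Kₜ) * (Wₛ + Wₜ)) + K₀ * (Wₛₛ + (2 : ℝ) • Wₛₜ + Wₜₜ)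
        = (Kₛₛ * W₀ + (2 : ℝ) • (Kₛ * Wₛ) + K₀ * Wₛₛ) + (Kₜₜ * W₀ + (2 : ℝ) • (Kₜ * Wₜ) + K₀ * Wₜₜ)
          + (2 : ℝ) • (Kₛₜ * W₀ + Kₛ * Wₜ + Kₜ * Wₛ + K₀ * Wₛₜ) := by
      simp only [Matrix.add_mul, Matrix.mul_add, Matrix.smul_mul, Matrix.mul_smul, smul_add]
      abel
    rw [e, aₛₛ, aₜₜ, aₛₜ, smul_zero, add_zero, add_zero]
  have dK2t : (Kₛₛ + (2 : ℝ) • Kₛₜ + Kₜₜ)ᵀ * W₀ + (2 : ℝ) • ((Kₛ + Kₜ)ᵀ * (Wₛ + Wₜ)) + K₀ᵀ * (Wₛₛ + (2 : ℝ) • Wₛₜ + Wₜₜ) = 0 := by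
    have e : (Kₛₛ + (2 : ℝ) • Kₛₜ + Kₜₜ)ᵀ * W₀ + (2 : ℝ) • ((Kₛ + Kₜ)ᵀ * (Wₛ + Wₜ)) + K₀ᵀ * (Wₛₛ + (2 : ℝ) • Wₛₜ + Wₜₜ)
        = (Kₛₛᵀ * W₀ + (2 : ℝ) • (Kₛᵀ * Wₛ) + K₀ᵀ * Wₛₛ) + (Kₜₜᵀ * W₀ + (2 : ℝ) • (Kₜᵀ * Wₜ) + K₀ᵀ * Wₜₜ)
          + (2 : ℝ) • (Kₛₜᵀ * W₀ + Kₛᵀ * Wₜ + Kₜᵀ * Wₛ + K₀ᵀ * Wₛₜ) := by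
      simp only [Matrix.transpose_add, Matrix.transpose_smul, Matrix.add_mul, Matrix.mul_add, Matrix.smul_mul, Matrix.mul_smul, smul_add]
      abel
    rw [e, aₛₛt, aₜₜt, aₛₜt, smul_zero, add_zero, add_zero]
  have dQ1 : (Qₛ + Qₜ) * W₀ + Q₀ * (Wₛ + Wₜ) = 0 := by
    rw [Matrix.add_mul, Matrix.mul_add]; rw [← bₛ, ← add_zero (Qₛ * W₀ + Q₀ * Wₛ), ← bₜ]; abel
  have dQ2 : (Qₛₛ + (2 : ℝ) • Qₛₜ + Qₜₜ) * W₀ + (2 : ℝ) • ((Qₛ + Qₜ) * (Wₛ + Wₜ)) + Q₀ * (Wₛₛ + (2 : ℝ) • Wₛₜ + Wₜₜ) = 0 := by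
    have e : (Qₛₛ + (2 : ℝ) • Qₛₜ + Qₜₜ) * W₀ + (2 : ℝ) • ((Qₛ + Qₜ) * (Wₛ + Wₜ)) + Q₀ * (Wₛₛ + (2 : ℝ) • Wₛₜ + Wₜₜ)
        = (Qₛₛ * W₀ + (2 : ℝ) • (Qₛ * Wₛ) + Q₀ * Wₛₛ) + (Qₜₜ * W₀ + (2 : ℝ) • (Qₜ * Wₜ) + Q₀ * Wₜₜ)
          + (2 : ℝ) • (Qₛₜ * W₀ + Qₛ * Wₜ + Qₜ * Wₛ + Q₀ * Wₛₜ) := by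
      simp only [Matrix.add_mul, Matrix.mul_add, Matrix.smul_mul, Matrix.mul_smul, smul_add]
      abel
    rw [e, bₛₛ, bₜₜ, bₛₜ, smul_zero, add_zero, add_zero]
  have hd := secondVar_sliceTransfer_jets K₀ (Kₛ + Kₜ) (Kₛₛ + (2 : ℝ) • Kₛₜ + Kₜₜ) Q₀ (Qₛ + Qₜ) (Qₛₛ + (2 : ℝ) • Qₛₜ + Qₜₜ)
    P₀ (Pₛ + Pₜ) (Pₛₛ + (2 : ℝ) • Pₛₜ + Pₜₜ) W₀ (Wₛ + Wₜ) (Wₛₛ + (2 : ℝ) • Wₛₜ + Wₜₜ) τ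
    a0 a0t dK1 dK1t dK2 dK2t b0 dQ1 dQ2 hτ hP hM
  -- polarise each of the four functionals
  have pM : secondVar (kkt K₀ (fromRows Q₀ τ)) (kkt (Kₛ + Kₜ) (fromRows (Qₛ + Qₜ) (0 : Matrix ρ ν ℝ)))
        (kkt (Kₛₛ + (2 : ℝ) • Kₛₜ + Kₜₜ) (fromRows (Qₛₛ + (2 : ℝ) • Qₛₜ + Qₜₜ) (0 : Matrix ρ ν ℝ)))
      = secondVar (kkt K₀ (fromRows Q₀ τ)) (kkt Kₛ (fromRows Qₛ 0)) (kkt Kₛₛ (fromRows Qₛₛ 0))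
        + secondVar (kkt K₀ (fromRows Q₀ τ)) (kkt Kₜ (fromRows Qₜ 0)) (kkt Kₜₜ (fromRows Qₜₜ 0))
        + 2 * mixedVar (kkt K₀ (fromRows Q₀ τ)) (kkt Kₛ (fromRows Qₛ 0)) (kkt Kₜ (fromRows Qₜ 0)) (kkt Kₛₜ (fromRows Qₛₜ 0)) := by
    rw [kkt_fromRows_add, kkt_fromRows_add, kkt_fromRows_add, kkt_fromRows_smul]
    exact secondVar_diag _ _ _ _ _ _
  have pF : secondVar (P₀ * W₀) ((Pₛ + Pₜ) * W₀ + P₀ * (Wₛ + Wₜ))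
        ((Pₛₛ + (2 : ℝ) • Pₛₜ + Pₜₜ) * W₀ + (Pₛ + Pₜ) * (Wₛ + Wₜ) + ((Pₛ + Pₜ) * (Wₛ + Wₜ) + P₀ * (Wₛₛ + (2 : ℝ) • Wₛₜ + Wₜₜ)))
      = secondVar (P₀ * W₀) (Pₛ * W₀ + P₀ * Wₛ) (Pₛₛ * W₀ + Pₛ * Wₛ + (Pₛ * Wₛ + P₀ * Wₛₛ))
        + secondVar (P₀ * W₀) (Pₜ * W₀ + P₀ * Wₜ) (Pₜₜ * W₀ + Pₜ * Wₜ + (Pₜ * Wₜ + P₀ * Wₜₜ))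
        + 2 * mixedVar (P₀ * W₀) (Pₛ * W₀ + P₀ * Wₛ) (Pₜ * W₀ + P₀ * Wₜ) (Pₛₜ * W₀ + Pₛ * Wₜ + Pₜ * Wₛ + P₀ * Wₛₜ) := by
    have e1 : (Pₛ + Pₜ) * W₀ + P₀ * (Wₛ + Wₜ) = (Pₛ * W₀ + P₀ * Wₛ) + (Pₜ * W₀ + P₀ * Wₜ) := by
      rw [Matrix.add_mul, Matrix.mul_add]; abel
    have e2 : (Pₛₛ + (2 : ℝ) • Pₛₜ + Pₜₜ) * W₀ + (Pₛ + Pₜ) * (Wₛ + Wₜ) + ((Pₛ + Pₜ) * (Wₛ + Wₜ) + P₀ * (Wₛₛ + (2 : ℝ) • Wₛₜ + Wₜₜ))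
        = (Pₛₛ * W₀ + Pₛ * Wₛ + (Pₛ * Wₛ + P₀ * Wₛₛ)) + (2 : ℝ) • (Pₛₜ * W₀ + Pₛ * Wₜ + Pₜ * Wₛ + P₀ * Wₛₜ)
          + (Pₜₜ * W₀ + Pₜ * Wₜ + (Pₜ * Wₜ + P₀ * Wₜₜ)) := by
      simp only [Matrix.add_mul, Matrix.mul_add, smul_add, two_smul]
      abel
    rw [e1, e2]
    exact secondVar_diag _ _ _ _ _ _
  have pN : secondVar (kkt (K₀ + P₀ᵀ * P₀) Q₀) (kkt (Kₛ + Kₜ + ((Pₛ + Pₜ)ᵀ * P₀ + P₀ᵀ * (Pₛ + Pₜ))) (Qₛ + Qₜ))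
        (kkt (Kₛₛ + (2 : ℝ) • Kₛₜ + Kₜₜ + ((Pₛₛ + (2 : ℝ) • Pₛₜ + Pₜₜ)ᵀ * P₀ + (Pₛ + Pₜ)ᵀ * (Pₛ + Pₜ)
          + ((Pₛ + Pₜ)ᵀ * (Pₛ + Pₜ) + P₀ᵀ * (Pₛₛ + (2 : ℝ) • Pₛₜ + Pₜₜ)))) (Qₛₛ + (2 : ℝ) • Qₛₜ + Qₜₜ))
      = secondVar (kkt (K₀ + P₀ᵀ * P₀) Q₀) (kkt (Kₛ + (Pₛᵀ * P₀ + P₀ᵀ * Pₛ)) Qₛ) (kkt (Kₛₛ + (Pₛₛᵀ * P₀ + Pₛᵀ * Pₛ + (Pₛᵀ * Pₛ + P₀ᵀ * Pₛₛ))) Qₛₛ)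
        + secondVar (kkt (K₀ + P₀ᵀ * P₀) Q₀) (kkt (Kₜ + (Pₜᵀ * P₀ + P₀ᵀ * Pₜ)) Qₜ) (kkt (Kₜₜ + (Pₜₜᵀ * P₀ + Pₜᵀ * Pₜ + (Pₜᵀ * Pₜ + P₀ᵀ * Pₜₜ))) Qₜₜ)
        + 2 * mixedVar (kkt (K₀ + P₀ᵀ * P₀) Q₀) (kkt (Kₛ + (Pₛᵀ * P₀ + P₀ᵀ * Pₛ)) Qₛ) (kkt (Kₜ + (Pₜᵀ * P₀ + P₀ᵀ * Pₜ)) Qₜ)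
            (kkt (Kₛₜ + (Pₛₜᵀ * P₀ + Pₛᵀ * Pₜ + Pₜᵀ * Pₛ + P₀ᵀ * Pₛₜ)) Qₛₜ) := by
    have e1 : kkt (Kₛ + Kₜ + ((Pₛ + Pₜ)ᵀ * P₀ + P₀ᵀ * (Pₛ + Pₜ))) (Qₛ + Qₜ)
        = kkt (Kₛ + (Pₛᵀ * P₀ + P₀ᵀ * Pₛ)) Qₛ + kkt (Kₜ + (Pₜᵀ * P₀ + P₀ᵀ * Pₜ)) Qₜ := by
      rw [← kkt_add]; congr 1
      simp only [Matrix.transpose_add, Matrix.add_mul, Matrix.mul_add]; abel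
    have e2 : kkt (Kₛₛ + (2 : ℝ) • Kₛₜ + Kₜₜ + ((Pₛₛ + (2 : ℝ) • Pₛₜ + Pₜₜ)ᵀ * P₀ + (Pₛ + Pₜ)ᵀ * (Pₛ + Pₜ)
          + ((Pₛ + Pₜ)ᵀ * (Pₛ + Pₜ) + P₀ᵀ * (Pₛₛ + (2 : ℝ) • Pₛₜ + Pₜₜ)))) (Qₛₛ + (2 : ℝ) • Qₛₜ + Qₜₜ)
        = kkt (Kₛₛ + (Pₛₛᵀ * P₀ + Pₛᵀ * Pₛ + (Pₛᵀ * Pₛ + P₀ᵀ * Pₛₛ))) Qₛₛ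
          + (2 : ℝ) • kkt (Kₛₜ + (Pₛₜᵀ * P₀ + Pₛᵀ * Pₜ + Pₜᵀ * Pₛ + P₀ᵀ * Pₛₜ)) Qₛₜ
          + kkt (Kₜₜ + (Pₜₜᵀ * P₀ + Pₜᵀ * Pₜ + (Pₜᵀ * Pₜ + P₀ᵀ * Pₜₜ))) Qₜₜ := by
      rw [← kkt_smul, ← kkt_add, ← kkt_add]; congr 1
      simp only [Matrix.transpose_add, Matrix.add_mul, Matrix.mul_add, smul_add, two_smul]
      abel
    rw [e1, e2]
    exact secondVar_diag _ _ _ _ _ _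
  have pG : secondVar (τ * W₀) (τ * (Wₛ + Wₜ)) (τ * (Wₛₛ + (2 : ℝ) • Wₛₜ + Wₜₜ))
      = secondVar (τ * W₀) (τ * Wₛ) (τ * Wₛₛ) + secondVar (τ * W₀) (τ * Wₜ) (τ * Wₜₜ)
        + 2 * mixedVar (τ * W₀) (τ * Wₛ) (τ * Wₜ) (τ * Wₛₜ) := by
    rw [Matrix.mul_add, Matrix.mul_add, Matrix.mul_add, Matrix.mul_smul]
    exact secondVar_diag _ _ _ _ _ _
  rw [pM, pF, pN, pG] at hd
  linarith

end Main

end Summit.QuantumFields.BalabanUV.Beta.D1BFx.SliceTransferJetsMixed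

end
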